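import Literature.NumberTheory.LFunctions.KeiperLiAsymptoticCriteria
import Mathlib.NumberTheory.Bernoulli
import Mathlib.RingTheory.PowerSeries.Exp
import HarnessLib

/-!
# RH-FREE corpus typing (cell `rh-crit/dbl`, seat t13): the Stieltjes constants as alternating series —
# Coffey 2008, §5, Proposition 5.1

LINE 1 — LABEL: RH-FREE corpus typing AND proof.  [Coffey2008] §5, **Proposition 5.1, eq. (5.1) p.720**:
for integers `k ≥ 0`,

  `γ_k = (1/ln 2)(1/(k+1)) Σ_{n≥2} ((−1)ⁿ/n) lnᵏ⁺¹ n
        − k! Σ_{ℓ=1}^{k} [B_{k−ℓ+1} ln^{k−ℓ} 2 /((k−ℓ+1)! ℓ!)] Σ_{n≥1} ((−1)ⁿ⁻¹/n) ln^ℓ n − (B_{k+1}/(k+1)) lnᵏ⁺¹ 2`,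

`γ_k` the Stieltjes constants (tree: `stieltjesGamma`, [Coffey2008] (3.1)–(3.2), sibling
`KeiperLiAsymptoticCriteria.lean`), `B_j` the Bernoulli numbers with `B₁ = −½` (Mathlib `bernoulli`; the
convention is forced by Remark 5.3 (ii) p.720: «for `k = 0` … `γ = (1/ln 2) Σ_{n≥2} (−1)ⁿ ln n/n + ½ ln 2`»).
The two-dimensional layout of the printed display is re-assembled from the publisher's text layer as
recorded (and numerically verified to 13 decimals for `k ≤ 4`) in the cell's locator file
`dbl/LIT-LOCATORS-dbl.md` §11; the statement below is that re-assembly, term by term.  Typed AND PROVED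
(`Coffey2008_prop51`), no named fact.  bears_on: LADDER-RH L-C/L-P (COLUMN 4 LI).  WHAT THIS IS NOT:
series bookkeeping for the Laurent coefficients of `ζ` at `s = 1`; no zero of `ζ` is involved and nothing
here bears on the truth of RH.

## Objects

* `altLogPowSeq ℓ N = Σ_{n=1}^{N} (−1)ⁿ⁻¹ lnˡ n / n` and its limit `altLogPow ℓ` — Coffey's inner sums
  `Σ_{n≥1} ((−1)ⁿ⁻¹/n) ln^ℓ n` (CONDITIONALLY convergent, hence typed as limits of partial sums, not as
  `tsum`); the first printed sum is `Σ_{n≥2} ((−1)ⁿ/n) lnᵏ⁺¹ n = −altLogPow (k+1)` (the `n = 1` term vanishes).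

## The printed proof and the road taken here

Coffey inserts the Dirichlet series of the alternating zeta function `(1−2^{1−s})ζ(s) = Σ (−1)ⁿ⁻¹ n^{−s}`
((5.4)), expanded termwise at `s = 1` ((5.5), whose coefficients are the `altLogPow ℓ`), and the Bernoulli
expansion (5.6) `(1−2^{1−s})^{−1} = 1/(ln 2 (s−1)) − Σ_{j≥0} ((−1)ʲ B_{j+1}/(j+1)!) lnʲ 2 (s−1)ʲ` into
`ζ = (1−2^{1−s})^{−1} · Σ(−1)ⁿ⁻¹n^{−s}` and compares with (3.1).  Differentiating a conditionally convergent
Dirichlet series termwise ON its abscissa of convergence is not available in Mathlib, so we DEVIATE at (5.5):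

1. (`tendsto_altLogPowSeq`, `altLogPow_eq`) ELEMENTARY convergence and closed form of the alternating sums
   from the Stieltjes limits (3.2) (tree: `tendsto_stieltjesGammaSeq`), by splitting the even partial sums
   `Σ_{n≤2N} (−1)ⁿ⁻¹ lnˡ n/n = Σ_{n≤2N} lnˡ n/n − Σ_{m≤N} (ln 2 + ln m)ˡ/m`:
   `altLogPow ℓ = lnˡ⁺¹ 2/(ℓ+1) − Σ_{i<ℓ} C(ℓ,i) ln^{ℓ−i} 2 · γ_i`.
   Coefficientwise this IS Coffey's product (5.4)·(5.5) of the two series `(1 − 2^{1−s})/(s−1)` and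
   `(s−1)ζ(s) = 1 + Σ (−1)ⁿ γ_n (s−1)ⁿ⁺¹/n!` ((3.1), tree `Coffey2008_eq31`), i.e. (5.7) read backwards.
2. (`Coffey2008_prop51`) formal power series over `ℝ`: with `Γ = 1 + Σ_n (−1)ⁿγ_n uⁿ⁺¹/n!`,
   `E = Σ_ℓ (−1)ˡ altLogPow ℓ · uˡ/ℓ!`, `G = (1 − e^{−u ln 2})/u`, step 1 says `E = G·Γ`; Mathlib's
   `bernoulliPowerSeries_mul_exp_sub_one` (`B(t)(eᵗ − 1) = t`), rescaled by `t = −u ln 2`, is (5.6):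
   `H·G = 1` for `H = B(−u ln 2)/ln 2`; hence `Γ = H·E`, whose coefficient of `uᵏ⁺¹` is (5.1).

Prop. 5.2 ((5.2)–(5.3), logarithmic polynomials) is NOT typed: its prefactors are not unambiguously
recoverable from the held text (locator file §11), and it has no downstream user.

## References

* [Coffey2008] M. W. Coffey, *New results concerning power series expansions of the Riemann xi function
  and the Li/Keiper constants*, Proc. R. Soc. A 464 (2008) 711–731, §5, Prop. 5.1, eqs. (5.1),
  (5.4)–(5.7), Remark 5.3, p.720–721 (held `paper:doi-10-1098-rspa-2007-0212`, PDF p.10–11).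
-/

noncomputable section

open Filter Topology Finset

namespace Literature.NumberTheory.LFunctions

/-! ## §1. Coffey's alternating sums `Σ_{n≥1} ((−1)ⁿ⁻¹/n) lnˡ n` -/

/-- RH-FREE (definition). Partial sums of Coffey's alternating series: `Σ_{n=1}^{N} (−1)ⁿ⁻¹ lnˡ n / n`
([Coffey2008] (5.1), (5.5): the coefficients of the alternating zeta function `Σ (−1)ⁿ⁻¹ n^{−s}` expanded
at `s = 1`). [cite: Coffey2008, Prop. 5.1 eq. (5.1) and eq. (5.5) p.720] -/
def altLogPowSeq (ℓ N : ℕ) : ℝ :=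
  ∑ n ∈ Finset.Icc 1 N, (-1 : ℝ) ^ (n + 1) * (Real.log n ^ ℓ / n)

/-- RH-FREE (definition). **Coffey's alternating sums** `Σ_{n≥1} ((−1)ⁿ⁻¹/n) lnˡ n := lim_N altLogPowSeq ℓ N`
(conditionally convergent; the limit exists, `tendsto_altLogPowSeq`; `ℓ = 0`: `ln 2`). Defined by
`limUnder`. [cite: Coffey2008, Prop. 5.1 eq. (5.1) p.720] -/
def altLogPow (ℓ : ℕ) : ℝ :=
  limUnder atTop (altLogPowSeq ℓ)

/-- The plain partial sums `S_ℓ(N) = Σ_{n≤N} lnˡ n/n` in terms of the Stieltjes sequence (3.2). [folklore] -/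
private theorem sum_log_pow_div_eq (ℓ N : ℕ) :
    ∑ n ∈ Finset.Icc 1 N, Real.log n ^ ℓ / n =
      stieltjesGammaSeq ℓ N + Real.log N ^ (ℓ + 1) / ((ℓ : ℝ) + 1) := by
  rw [stieltjesGammaSeq]; ring

/-- Even partial sums: `Σ_{n≤2N} (−1)ⁿ⁻¹ a_n = Σ_{n≤2N} a_n − Σ_{m≤N} lnˡ(2m)/m`. [folklore] -/
private theorem altLogPowSeq_two_mul (ℓ N : ℕ) :
    altLogPowSeq ℓ (2 * N) = (∑ n ∈ Finset.Icc 1 (2 * N), Real.log n ^ ℓ / n) -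
      ∑ m ∈ Finset.Icc 1 N, Real.log (2 * m) ^ ℓ / m := by
  induction N with
  | zero => simp [altLogPowSeq]
  | succ N ih =>
    rw [show 2 * (N + 1) = 2 * N + 1 + 1 by ring, altLogPowSeq, Finset.sum_Icc_succ_top (by omega),
      Finset.sum_Icc_succ_top (by omega), Finset.sum_Icc_succ_top (by omega),
      Finset.sum_Icc_succ_top (by omega), Finset.sum_Icc_succ_top (by omega), ← altLogPowSeq, ih]
    have h1 : (-1 : ℝ) ^ (2 * N + 1 + 1) = 1 := by
      rw [show 2 * N + 1 + 1 = 2 * (N + 1) by ring, pow_mul]; norm_num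
    have h2 : (-1 : ℝ) ^ (2 * N + 1 + 1 + 1) = -1 := by
      rw [pow_succ, h1]; norm_num
    rw [h1, h2]
    have h3 : Real.log (2 * ((N + 1 : ℕ) : ℝ)) ^ ℓ / ((N + 1 : ℕ) : ℝ) =
        2 * (Real.log ((2 * N + 1 + 1 : ℕ) : ℝ) ^ ℓ / ((2 * N + 1 + 1 : ℕ) : ℝ)) := by
      have hN : ((N : ℝ) + 1) ≠ 0 := by positivity
      push_cast
      rw [show (2 : ℝ) * N + 1 + 1 = 2 * (N + 1) by ring]
      field_simp
    rw [h3]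
    ring

/-- `Σ_{m≤N} lnˡ(2m)/m = Σ_i C(ℓ,i) ln^{ℓ−i} 2 · S_i(N)` (binomial theorem). [folklore] -/
private theorem sum_log_two_mul_pow_div (ℓ N : ℕ) :
    ∑ m ∈ Finset.Icc 1 N, Real.log (2 * m) ^ ℓ / m =
      ∑ i ∈ Finset.range (ℓ + 1), (ℓ.choose i : ℝ) * Real.log 2 ^ (ℓ - i) *
        ∑ m ∈ Finset.Icc 1 N, Real.log m ^ i / m := by
  have hterm : ∀ m ∈ Finset.Icc 1 N, Real.log (2 * m) ^ ℓ / m =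
      ∑ i ∈ Finset.range (ℓ + 1), (ℓ.choose i : ℝ) * Real.log 2 ^ (ℓ - i) * (Real.log m ^ i / m) := by
    intro m hm
    have hm0 : (m : ℝ) ≠ 0 := by exact_mod_cast (show m ≠ 0 by have := (Finset.mem_Icc.1 hm).1; omega)
    rw [Real.log_mul two_ne_zero hm0, add_comm, add_pow, Finset.sum_div]
    refine Finset.sum_congr rfl fun i _ ↦ ?_
    ring
  rw [Finset.sum_congr rfl hterm, Finset.sum_comm]
  refine Finset.sum_congr rfl fun i _ ↦ ?_
  rw [Finset.mul_sum]

/-- `Σ_{i≤ℓ} C(ℓ,i) x^{ℓ−i} y^{i+1}/(i+1) = ((x+y)^{ℓ+1} − x^{ℓ+1})/(ℓ+1)`. [folklore] -/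
private theorem sum_choose_mul_pow_mul_pow_div (ℓ : ℕ) (x y : ℝ) :
    ∑ i ∈ Finset.range (ℓ + 1), (ℓ.choose i : ℝ) * x ^ (ℓ - i) * (y ^ (i + 1) / ((i : ℝ) + 1)) =
      ((x + y) ^ (ℓ + 1) - x ^ (ℓ + 1)) / ((ℓ : ℝ) + 1) := by
  have hℓ : ((ℓ : ℝ) + 1) ≠ 0 := by positivity
  have hrhs : (x + y) ^ (ℓ + 1) - x ^ (ℓ + 1) =
      ∑ i ∈ Finset.range (ℓ + 1), y ^ (i + 1) * x ^ (ℓ - i) * ((ℓ + 1).choose (i + 1) : ℝ) := by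
    rw [add_comm x y, add_pow, Finset.sum_range_succ']
    simp only [pow_zero, Nat.sub_zero, Nat.choose_zero_right, Nat.cast_one, one_mul, mul_one,
      add_sub_cancel_right]
    refine Finset.sum_congr rfl fun i _ ↦ ?_
    rw [show ℓ + 1 - (i + 1) = ℓ - i by omega]
  rw [eq_div_iff hℓ, Finset.sum_mul, hrhs]
  refine Finset.sum_congr rfl fun i _ ↦ ?_
  have hc : ((ℓ + 1 : ℕ) : ℝ) * (ℓ.choose i : ℝ) = ((ℓ + 1).choose (i + 1) : ℝ) * ((i : ℝ) + 1) := by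
    exact_mod_cast Nat.add_one_mul_choose_eq ℓ i
  have hi0 : ((i : ℝ) + 1) ≠ 0 := by positivity
  field_simp
  push_cast at hc ⊢
  linear_combination x ^ (ℓ - i) * y ^ (i + 1) * hc

/-- `(2N+1 : ℝ) → ∞` along `ℕ`. [folklore] -/
private theorem tendsto_two_mul_add_one_atTop :
    Tendsto (fun N : ℕ ↦ (2 * (N : ℝ) + 1)) atTop atTop := by
  refine tendsto_atTop_mono (fun N ↦ ?_) tendsto_natCast_atTop_atTop
  linarith [(N.cast_nonneg : (0 : ℝ) ≤ N)]

/-- A sequence converges if its even- and odd-indexed subsequences converge to the same limit. [folklore] -/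
private theorem tendsto_of_even_odd {f : ℕ → ℝ} {L : ℝ} (he : Tendsto (fun N ↦ f (2 * N)) atTop (𝓝 L))
    (ho : Tendsto (fun N ↦ f (2 * N + 1)) atTop (𝓝 L)) : Tendsto f atTop (𝓝 L) := by
  rw [Metric.tendsto_atTop] at he ho ⊢
  intro ε hε
  obtain ⟨N₁, h₁⟩ := he ε hε
  obtain ⟨N₂, h₂⟩ := ho ε hε
  refine ⟨2 * max N₁ N₂ + 1, fun n hn ↦ ?_⟩
  obtain ⟨m, rfl | rfl⟩ := Nat.even_or_odd' n
  · exact h₁ m (by omega)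
  · exact h₂ m (by omega)

/-- RH-FREE, PROVED. **Convergence and value of Coffey's alternating sums**: for every `ℓ`,
`Σ_{n≤N} (−1)ⁿ⁻¹ lnˡ n/n → lnˡ⁺¹ 2/(ℓ+1) + γ_ℓ − Σ_{i≤ℓ} C(ℓ,i) ln^{ℓ−i} 2 · γ_i` (the `i = ℓ` term
cancels `γ_ℓ`).  Elementary: the even partial sums are `S_ℓ(2N) − Σ_i C(ℓ,i) ln^{ℓ−i}2 · S_i(N)` with
`S_i(N) = Σ_{n≤N} lnⁱ n/n = γ_i(N) + lnⁱ⁺¹ N/(i+1)` ((3.2)), and the divergent `ln`-powers cancel exactly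
to `lnˡ⁺¹ 2/(ℓ+1)`; the odd partial sums differ by `lnˡ(2N+1)/(2N+1) → 0`.  This is the coefficientwise
content of [Coffey2008] (5.4)–(5.5), (5.7). [cite: Coffey2008, eqs. (5.4)–(5.5), (5.7) p.720–721] -/
theorem tendsto_altLogPowSeq (ℓ : ℕ) :
    Tendsto (altLogPowSeq ℓ) atTop (𝓝 (Real.log 2 ^ (ℓ + 1) / ((ℓ : ℝ) + 1) + stieltjesGamma ℓ -
      ∑ i ∈ Finset.range (ℓ + 1), (ℓ.choose i : ℝ) * Real.log 2 ^ (ℓ - i) * stieltjesGamma i)) := by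
  set L : ℝ := Real.log 2 ^ (ℓ + 1) / ((ℓ : ℝ) + 1) + stieltjesGamma ℓ -
    ∑ i ∈ Finset.range (ℓ + 1), (ℓ.choose i : ℝ) * Real.log 2 ^ (ℓ - i) * stieltjesGamma i with hL
  -- even partial sums, exactly
  have heven : ∀ N : ℕ, 1 ≤ N → altLogPowSeq ℓ (2 * N) =
      Real.log 2 ^ (ℓ + 1) / ((ℓ : ℝ) + 1) + stieltjesGammaSeq ℓ (2 * N) -
        ∑ i ∈ Finset.range (ℓ + 1), (ℓ.choose i : ℝ) * Real.log 2 ^ (ℓ - i) * stieltjesGammaSeq i N := by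
    intro N hN
    have hN0 : (N : ℝ) ≠ 0 := by exact_mod_cast (show N ≠ 0 by omega)
    rw [altLogPowSeq_two_mul, sum_log_two_mul_pow_div, sum_log_pow_div_eq]
    simp only [sum_log_pow_div_eq]
    have hlog : Real.log ((2 * N : ℕ) : ℝ) = Real.log 2 + Real.log N := by
      push_cast; exact Real.log_mul two_ne_zero hN0
    rw [hlog]
    have hid := sum_choose_mul_pow_mul_pow_div ℓ (Real.log 2) (Real.log N)
    have hsplit : ∑ i ∈ Finset.range (ℓ + 1), (ℓ.choose i : ℝ) * Real.log 2 ^ (ℓ - i) *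
        (stieltjesGammaSeq i N + Real.log N ^ (i + 1) / ((i : ℝ) + 1)) =
        ∑ i ∈ Finset.range (ℓ + 1), (ℓ.choose i : ℝ) * Real.log 2 ^ (ℓ - i) * stieltjesGammaSeq i N +
        ∑ i ∈ Finset.range (ℓ + 1), (ℓ.choose i : ℝ) * Real.log 2 ^ (ℓ - i) *
          (Real.log N ^ (i + 1) / ((i : ℝ) + 1)) := by
      rw [← Finset.sum_add_distrib]
      refine Finset.sum_congr rfl fun i _ ↦ ?_
      ring
    rw [hsplit, hid]
    ring
  have heven' : Tendsto (fun N ↦ altLogPowSeq ℓ (2 * N)) atTop (𝓝 L) := by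
    have h2N : Tendsto (fun N : ℕ ↦ 2 * N) atTop atTop :=
      tendsto_id.const_mul_atTop' (by norm_num : 0 < 2)
    have hA : Tendsto (fun N ↦ stieltjesGammaSeq ℓ (2 * N)) atTop (𝓝 (stieltjesGamma ℓ)) :=
      (tendsto_stieltjesGammaSeq ℓ).comp h2N
    have hB : Tendsto (fun N ↦ ∑ i ∈ Finset.range (ℓ + 1), (ℓ.choose i : ℝ) * Real.log 2 ^ (ℓ - i) *
        stieltjesGammaSeq i N) atTop
        (𝓝 (∑ i ∈ Finset.range (ℓ + 1), (ℓ.choose i : ℝ) * Real.log 2 ^ (ℓ - i) * stieltjesGamma i)) :=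
      tendsto_finsetSum _ fun i _ ↦ (tendsto_stieltjesGammaSeq i).const_mul _
    have hC := (tendsto_const_nhds (x := Real.log 2 ^ (ℓ + 1) / ((ℓ : ℝ) + 1))).add hA
    have hD := hC.sub hB
    refine (hD.congr' ?_)
    filter_upwards [eventually_ge_atTop 1] with N hN
    rw [heven N hN]
  -- odd partial sums
  have hodd' : Tendsto (fun N ↦ altLogPowSeq ℓ (2 * N + 1)) atTop (𝓝 L) := by
    have hstep : ∀ N : ℕ, altLogPowSeq ℓ (2 * N + 1) =
        altLogPowSeq ℓ (2 * N) + Real.log (2 * (N : ℝ) + 1) ^ ℓ / (2 * (N : ℝ) + 1) := by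
      intro N
      rw [altLogPowSeq, Finset.sum_Icc_succ_top (by omega), ← altLogPowSeq]
      have h1 : (-1 : ℝ) ^ (2 * N + 1 + 1) = 1 := by
        rw [show 2 * N + 1 + 1 = 2 * (N + 1) by ring, pow_mul]; norm_num
      rw [h1]
      push_cast
      ring
    have hsmall : Tendsto (fun N : ℕ ↦ Real.log (2 * (N : ℝ) + 1) ^ ℓ / (2 * (N : ℝ) + 1)) atTop (𝓝 0) := by
      have h := (Real.tendsto_pow_log_div_mul_add_atTop 1 0 ℓ one_ne_zero).comp
        tendsto_two_mul_add_one_atTop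
      refine h.congr fun N ↦ ?_
      simp
    have h := heven'.add hsmall
    rw [add_zero] at h
    exact h.congr fun N ↦ (hstep N).symm
  exact tendsto_of_even_odd heven' hodd'

/-- RH-FREE, PROVED. The limit defining `altLogPow ℓ` exists and equals it. [cite: Coffey2008, eq. (5.1) p.720] -/
theorem tendsto_altLogPowSeq_altLogPow (ℓ : ℕ) :
    Tendsto (altLogPowSeq ℓ) atTop (𝓝 (altLogPow ℓ)) :=
  tendsto_nhds_limUnder ⟨_, tendsto_altLogPowSeq ℓ⟩

/-- RH-FREE, PROVED. **Closed form**: `Σ_{n≥1} ((−1)ⁿ⁻¹/n) lnˡ n = lnˡ⁺¹ 2/(ℓ+1) − Σ_{i<ℓ} C(ℓ,i) ln^{ℓ−i} 2 · γ_i`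
(`γ_i` the Stieltjes constants; `ℓ = 0`: `ln 2`; `ℓ = 1`: `½ ln² 2 − γ ln 2`).
[cite: Coffey2008, eqs. (5.4)–(5.5), (5.7) p.720–721] -/
theorem altLogPow_eq (ℓ : ℕ) :
    altLogPow ℓ = Real.log 2 ^ (ℓ + 1) / ((ℓ : ℝ) + 1) -
      ∑ i ∈ Finset.range ℓ, (ℓ.choose i : ℝ) * Real.log 2 ^ (ℓ - i) * stieltjesGamma i := by
  have h := tendsto_nhds_unique (tendsto_altLogPowSeq_altLogPow ℓ) (tendsto_altLogPowSeq ℓ)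
  rw [h, Finset.sum_range_succ, Nat.choose_self, Nat.sub_self]
  simp only [Nat.cast_one, pow_zero, one_mul, mul_one]
  ring

/-- RH-FREE, PROVED. `Σ_{n≥1} (−1)ⁿ⁻¹/n = ln 2` ([Coffey2008] p.720: «the `ℓ = 0` term of a product of sums
gives simply a factor of `ln 2`»). [cite: Coffey2008, proof of Prop. 5.1 p.720] -/
theorem altLogPow_zero : altLogPow 0 = Real.log 2 := by
  rw [altLogPow_eq]; simp

/-- RH-FREE, PROVED. The first printed sum of (5.1), `Σ_{n≥2} ((−1)ⁿ/n) lnᵏ⁺¹ n`, is `−altLogPow (k+1)`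
(the `n = 1` term of `altLogPow` vanishes): its partial sums from `n = 2` converge to `−altLogPow (k+1)`.
[cite: Coffey2008, Prop. 5.1 eq. (5.1) p.720] -/
theorem tendsto_sum_Icc_two_neg_one_pow_mul_log_pow_div (k : ℕ) :
    Tendsto (fun N : ℕ ↦ ∑ n ∈ Finset.Icc 2 N, (-1 : ℝ) ^ n * (Real.log n ^ (k + 1) / n)) atTop
      (𝓝 (-altLogPow (k + 1))) := by
  have h := (tendsto_altLogPowSeq_altLogPow (k + 1)).neg
  refine h.congr' ?_
  filter_upwards [eventually_ge_atTop 1] with N hN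
  rw [altLogPowSeq]
  have hI : Finset.Icc 1 N = insert 1 (Finset.Icc 2 N) := by
    ext n; simp only [Finset.mem_insert, Finset.mem_Icc]; omega
  rw [hI, Finset.sum_insert (by simp), Nat.cast_one, Real.log_one, zero_pow (Nat.succ_ne_zero k),
    zero_div, mul_zero, zero_add, ← Finset.sum_neg_distrib]
  refine Finset.sum_congr rfl fun n _ ↦ ?_
  rw [pow_succ]
  ring

/-! ## §2. Proposition 5.1: the Stieltjes constants through the alternating sums and Bernoulli numbers -/

open PowerSeries in
/-- **Convolution form of Prop. 5.1** (the coefficient of `uᵏ⁺¹` in `(s−1)ζ(s) = H(u)·E(u)`,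
`u = s − 1`, `H(u) = u/(1−2^{−u}) = B(−u ln 2)/ln 2` = (5.6), `E(u) = Σ_ℓ (−1)ˡ altLogPow ℓ · uˡ/ℓ!`
= (5.5) summed over `n`): for every `k`,
`(−1)ᵏ γ_k/k! = Σ_{j=0}^{k+1} [(1/ln 2) (−ln 2)ʲ B_j/j!] · [(−1)^{k+1−j} altLogPow (k+1−j)/(k+1−j)!]`.
Formal power series over `ℝ`; inputs `altLogPow_eq` (= (5.7) coefficientwise) and Mathlib's
`bernoulliPowerSeries_mul_exp_sub_one` (= (5.6)). [cite: Coffey2008, Prop. 5.1, proof p.720 (eqs. (5.4)–(5.7))] -/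
theorem Coffey2008_prop51_conv (k : ℕ) :
    (-1 : ℝ) ^ k * stieltjesGamma k / (k.factorial : ℝ) =
      ∑ j ∈ Finset.range (k + 1 + 1), ((Real.log 2)⁻¹ * ((-Real.log 2) ^ j * (bernoulli j : ℝ) /
        (j.factorial : ℝ))) * ((-1 : ℝ) ^ (k + 1 - j) * altLogPow (k + 1 - j) /
          ((k + 1 - j).factorial : ℝ)) := by
  set c : ℝ := Real.log 2 with hc
  have hc0 : c ≠ 0 := (Real.log_pos one_lt_two).ne'
  -- the power series
  set Γ' : PowerSeries ℝ := PowerSeries.mk fun n ↦ (-1 : ℝ) ^ n * stieltjesGamma n / (n.factorial : ℝ)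
    with hΓ'
  set E : PowerSeries ℝ := PowerSeries.mk fun ℓ ↦ (-1 : ℝ) ^ ℓ * altLogPow ℓ / (ℓ.factorial : ℝ)
    with hE
  set G : PowerSeries ℝ := PowerSeries.mk fun j ↦ (-1 : ℝ) ^ j * c ^ (j + 1) / ((j + 1).factorial : ℝ)
    with hG
  set B : PowerSeries ℝ := rescale (-c) (bernoulliPowerSeries ℝ) with hB
  -- (5.7): `E = G·(1 + X Γ')`, coefficient by coefficient
  have hL : ∀ m : ℕ, (-1 : ℝ) ^ (m + 1) * (c ^ (m + 1 + 1) / (((m + 1 : ℕ) : ℝ) + 1) -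
      ∑ i ∈ Finset.range (m + 1), (((m + 1).choose i : ℕ) : ℝ) * c ^ (m + 1 - i) * stieltjesGamma i) /
        ((m + 1).factorial : ℝ) =
      (-1 : ℝ) ^ (m + 1) * c ^ (m + 1 + 1) / ((m + 1 + 1).factorial : ℝ) +
        ∑ i ∈ Finset.range (m + 1), (-1 : ℝ) ^ m * c ^ (m + 1 - i) * stieltjesGamma i /
          ((i.factorial : ℝ) * ((m + 1 - i).factorial : ℝ)) := by
    intro m
    have hf : ((m + 1).factorial : ℝ) ≠ 0 := by positivity
    have hm2 : (((m + 1 : ℕ) : ℝ) + 1) ≠ 0 := by positivity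
    rw [mul_sub, sub_div, sub_eq_add_neg]
    congr 1
    · rw [Nat.factorial_succ (m + 1)]
      push_cast
      field_simp
    · rw [Finset.mul_sum, Finset.sum_div, ← Finset.sum_neg_distrib]
      refine Finset.sum_congr rfl fun i hi ↦ ?_
      have hi' : i ≤ m + 1 := by have := Finset.mem_range.1 hi; omega
      have hcast : (((m + 1).choose i : ℕ) : ℝ) * (i.factorial : ℝ) * ((m + 1 - i).factorial : ℝ) =
          ((m + 1).factorial : ℝ) := by
        exact_mod_cast Nat.choose_mul_factorial_mul_factorial hi'
      have hi1 : (i.factorial : ℝ) ≠ 0 := by positivity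
      have hi2 : ((m + 1 - i).factorial : ℝ) ≠ 0 := by positivity
      rw [pow_succ]
      field_simp
      linear_combination (stieltjesGamma i) * hcast
  have hR : ∀ m : ℕ, ∑ x ∈ Finset.range (m + 1), (-1 : ℝ) ^ x * c ^ (x + 1) / ((x + 1).factorial : ℝ) *
        ((-1 : ℝ) ^ (m - x) * stieltjesGamma (m - x) / ((m - x).factorial : ℝ)) =
      ∑ i ∈ Finset.range (m + 1), (-1 : ℝ) ^ m * c ^ (m + 1 - i) * stieltjesGamma i /
        ((i.factorial : ℝ) * ((m + 1 - i).factorial : ℝ)) := by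
    intro m
    rw [← Finset.sum_range_reflect _ (m + 1)]
    refine Finset.sum_congr rfl fun j hj ↦ ?_
    have hj' : j ≤ m := by have := Finset.mem_range.1 hj; omega
    rw [show m + 1 - 1 - j = m - j by omega, show m - (m - j) = j by omega,
      show m - j + 1 = m + 1 - j by omega]
    have hsign : (-1 : ℝ) ^ m = (-1 : ℝ) ^ (m - j) * (-1) ^ j := by
      rw [← pow_add, Nat.sub_add_cancel hj']
    rw [hsign]
    ring
  have hEG : E = G * (1 + X * Γ') := by
    ext n
    rw [mul_add, mul_one, map_add, show G * (X * Γ') = X * (G * Γ') by ring]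
    cases n with
    | zero =>
      simp only [hE, hG, coeff_mk, coeff_zero_X_mul, add_zero, pow_zero, one_mul, Nat.factorial_zero,
        Nat.cast_one, div_one, zero_add, Nat.factorial_one, pow_one, altLogPow_zero]
      exact hc.symm
    | succ m =>
      rw [coeff_succ_X_mul, coeff_mul, Finset.Nat.sum_antidiagonal_eq_sum_range_succ_mk]
      simp only [hE, hG, hΓ', coeff_mk, Nat.succ_eq_add_one]
      rw [altLogPow_eq (m + 1), ← hc, hL m, hR m]
  -- (5.6): `B(−cu)·(e^{−cu} − 1) = −c·u`, whence `B·G = c`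
  have hXG : X * G = 1 - rescale (-c) (exp ℝ) := by
    ext n
    cases n with
    | zero =>
      simp only [coeff_zero_X_mul, map_sub, coeff_one, if_true, coeff_rescale, pow_zero, one_mul,
        coeff_exp, Nat.factorial_zero, Nat.cast_one, div_one, map_one, sub_self]
    | succ j =>
      rw [coeff_succ_X_mul]
      simp only [hG, coeff_mk, map_sub, coeff_one, Nat.succ_ne_zero, if_false, coeff_rescale, coeff_exp,
        eq_ratCast, zero_sub]
      push_cast
      rw [neg_pow c]
      ring
  have hBG : B * G = C c := by
    have h1 : B * (rescale (-c) (exp ℝ) - 1) = C (-c) * X := by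
      have h := congrArg (rescale (-c)) (bernoulliPowerSeries_mul_exp_sub_one ℝ)
      rwa [map_mul, map_sub, map_one, rescale_X] at h
    have h2 : X * (B * G) = X * C c := by
      calc X * (B * G) = -(B * (1 - X * G - 1)) := by ring
        _ = -(B * (rescale (-c) (exp ℝ) - 1)) := by rw [hXG]; ring
        _ = X * C c := by rw [h1, map_neg]; ring
    exact mul_left_cancel₀ X_ne_zero h2
  -- hence `1 + X Γ' = (B/c)·E`
  have hΓE : 1 + X * Γ' = C c⁻¹ * B * E := by
    rw [hEG, show C c⁻¹ * B * (G * (1 + X * Γ')) = C c⁻¹ * (B * G) * (1 + X * Γ') by ring, hBG,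
      ← map_mul, inv_mul_cancel₀ hc0, map_one, one_mul]
  -- coefficient of `u^{k+1}`
  have hk := congrArg (coeff (k + 1)) hΓE
  rw [map_add, coeff_one, if_neg (Nat.succ_ne_zero k), zero_add, coeff_succ_X_mul, mul_assoc, coeff_C_mul,
    coeff_mul, Finset.Nat.sum_antidiagonal_eq_sum_range_succ_mk, Finset.mul_sum] at hk
  simp only [hΓ', hE, hB, coeff_mk, coeff_rescale, bernoulliPowerSeries, eq_ratCast, Nat.succ_eq_add_one] at hk
  rw [hk]
  refine Finset.sum_congr rfl fun j _ ↦ ?_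
  push_cast
  ring

/-- RH-FREE NAMED STATEMENT, PROVED — **[Coffey2008] Proposition 5.1, eq. (5.1), p.720** («We have for
integers `k ≥ 0`»):

  `γ_k = (1/ln 2)·(1/(k+1))·Σ_{n≥2} ((−1)ⁿ/n) lnᵏ⁺¹ n
          − k! Σ_{ℓ=1}^{k} [B_{k−ℓ+1} ln^{k−ℓ} 2 /((k−ℓ+1)! ℓ!)] · Σ_{n≥1} ((−1)ⁿ⁻¹/n) ln^ℓ n
          − (B_{k+1}/(k+1)) lnᵏ⁺¹ 2`,

`γ_k = stieltjesGamma k` ((3.1)–(3.2)), `B_j = bernoulli j` (`B₁ = −½`, the convention of Remark 5.3 (ii)),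
the alternating sums being `altLogPow` (limits of partial sums; the first printed sum, starting at `n = 2`,
is `−altLogPow (k+1)`, see `tendsto_sum_Icc_two_neg_one_pow_mul_log_pow_div`).  The display is the
re-assembly of record of the printed two-dimensional layout (cell locator file §11, checked numerically
to 13 decimals for `k ≤ 4`).  Derived from the convolution form `Coffey2008_prop51_conv` by splitting off
the terms `j = 0` and `j = k+1` (`altLogPow 0 = ln 2`) and re-indexing `ℓ = k + 1 − j`.
[cite: Coffey2008, Prop. 5.1 eq. (5.1) p.720] -/
theorem Coffey2008_prop51 (k : ℕ) :
    stieltjesGamma k =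
      1 / Real.log 2 * (1 / ((k : ℝ) + 1)) * (-altLogPow (k + 1)) -
        (k.factorial : ℝ) * ∑ ℓ ∈ Finset.Icc 1 k,
          (bernoulli (k - ℓ + 1) : ℝ) * Real.log 2 ^ (k - ℓ) /
            (((k - ℓ + 1).factorial : ℝ) * (ℓ.factorial : ℝ)) * altLogPow ℓ -
        (bernoulli (k + 1) : ℝ) / ((k : ℝ) + 1) * Real.log 2 ^ (k + 1) := by
  have h := Coffey2008_prop51_conv k
  set c : ℝ := Real.log 2 with hc
  have hc0 : c ≠ 0 := (Real.log_pos one_lt_two).ne'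
  have hkf : (k.factorial : ℝ) ≠ 0 := by positivity
  have hk1 : ((k : ℝ) + 1) ≠ 0 := by positivity
  set S : ℝ := ∑ ℓ ∈ Finset.Icc 1 k, (bernoulli (k - ℓ + 1) : ℝ) * c ^ (k - ℓ) /
    (((k - ℓ + 1).factorial : ℝ) * (ℓ.factorial : ℝ)) * altLogPow ℓ with hS
  -- the middle sum of the convolution, re-indexed by `ℓ = k − j`
  have hmid : ∑ j ∈ Finset.range k, c⁻¹ * ((-c) ^ (j + 1) * (bernoulli (j + 1) : ℝ) /
      ((j + 1).factorial : ℝ)) * ((-1 : ℝ) ^ (k + 1 - (j + 1)) * altLogPow (k + 1 - (j + 1)) /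
        ((k + 1 - (j + 1)).factorial : ℝ)) = (-1 : ℝ) ^ (k + 1) * S := by
    rw [hS, Finset.mul_sum, ← Finset.Ico_add_one_right_eq_Icc, Finset.sum_Ico_eq_sum_range,
      show k + 1 - 1 = k by omega]
    conv_lhs => rw [← Finset.sum_range_reflect _ k]
    refine Finset.sum_congr rfl fun j hj ↦ ?_
    have hj' : j < k := Finset.mem_range.1 hj
    obtain ⟨d, hd⟩ : ∃ d, k - j = d + 1 := ⟨k - j - 1, by omega⟩
    rw [show k - 1 - j + 1 = k - j by omega, show k + 1 - (k - j) = j + 1 by omega,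
      show 1 + j = j + 1 by ring, show k - (j + 1) + 1 = k - j by omega, show k - (j + 1) = d by omega, hd]
    have hsign : (-1 : ℝ) ^ (k + 1) = (-1 : ℝ) ^ (d + 1) * (-1) ^ (j + 1) := by
      rw [← pow_add, show d + 1 + (j + 1) = k + 1 by omega]
    have hf1 : ((d + 1).factorial : ℝ) ≠ 0 := by positivity
    have hf2 : ((j + 1).factorial : ℝ) ≠ 0 := by positivity
    rw [hsign, neg_pow c, pow_succ c d]
    field_simp
  rw [Finset.sum_range_succ, Finset.sum_range_succ', hmid] at h
  have e : (-1 : ℝ) ^ k * stieltjesGamma k / (k.factorial : ℝ) =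
      (-1 : ℝ) ^ k * (1 / c * (1 / ((k : ℝ) + 1)) * (-altLogPow (k + 1)) - (k.factorial : ℝ) * S -
        (bernoulli (k + 1) : ℝ) / ((k : ℝ) + 1) * c ^ (k + 1)) / (k.factorial : ℝ) := by
    rw [h]
    simp only [Nat.sub_self, Nat.sub_zero, pow_zero, altLogPow_zero, ← hc, bernoulli_zero, Rat.cast_one,
      Nat.factorial_zero, Nat.cast_one, div_one, mul_one, one_mul, Nat.factorial_succ, Nat.cast_mul,
      Nat.cast_add, neg_pow c, pow_succ]
    field_simp
    ring
  have e2 := (div_left_inj' hkf).1 e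
  exact mul_left_cancel₀ (pow_ne_zero k (by norm_num : (-1 : ℝ) ≠ 0)) e2

end Literature.NumberTheory.LFunctions
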